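import Summits.QuantumFields.YangMills.Theorems.WeakCouplingRatesColdBoxForestPoincare
import Summits.QuantumFields.YangMills.Theorems.WeakCouplingRatesColdBoxDirichletPosDef

/-!
# Route `WeakCouplingRates`, crux `ColdBoxTwoPointFloorW` (stmt-QuantumFields-19608): the LINEAR forest Poincaré inequality for the
# Dirichlet edge variables (brick R2 of `PLAN-S3c-ii.md`, addendum 3)

Helper file (fleet seat `ym-wcr-19608-p2`; line `birth`).  The quantitative nonlinear Poincaré inequality in the temporal-forest gauge
`ell_le_uniform` (`Theorems/WeakCouplingRatesColdBoxForestPoincare.lean`: every link of a configuration that is `1` off the cold box and on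
the forest has `ℓ(V_e) ≤ (12H² + 2H + 1)·max_p ℓ(V_p)` for any length function `ℓ`) specialised to the ADDITIVE group
`G = Multiplicative ℝ`, `ℓ = |toAdd ·|`, and the glued Dirichlet edge function `dirGlue H s` of D1' (`0` off the cold box and on the forest
by `dirGlue_eq_zero_of_not_mem`, `dirGlue_eq_zero_of_forest`): **`|dirGlue H s e| ≤ (12H² + 2H + 1)·M` whenever all circulations satisfy
`|sCirc (dirGlue H s) p| ≤ M`** — the Gaussian-side input "links from plaquettes" of the large-field step R5 of the S3c-ii assembly.

No sorry, standard axioms; no new definition.  NOT a claim about the mass gap.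
-/

set_option autoImplicit false

noncomputable section

open Literature.Probability.LatticeModels
open Literature.MathematicalPhysics.QuantumLattice
open Literature.MathematicalPhysics.QuantumFieldTheory
open Literature.MathematicalPhysics.QuantumFieldTheory.LatticeMaxwell
open Literature.MathematicalPhysics.QuantumFieldTheory.AxialGauge

namespace Summit.QuantumFields.YangMills.Theorems.WeakCouplingRates

variable {H : ℕ}

/-- The additive holonomy of the multiplicative lift of an edge function is its circulation. -/
theorem toAdd_plaquetteHolonomyZd_ofAdd (A : Literature.MathematicalPhysics.QuantumLattice.ZdEdge 4 → ℝ) (x : Site 4) (i j : Fin 4) :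
    Multiplicative.toAdd (plaquetteHolonomyZd (fun e => Multiplicative.ofAdd (A e)) x i j) = sCirc A (x, i, j) := by
  simp only [plaquetteHolonomyZd, toAdd_mul, toAdd_inv, toAdd_ofAdd, sCirc]
  ring

/-- **Linear forest Poincaré inequality for the Dirichlet edge variables** (brick R2): if every circulation of the glued Dirichlet
edge function is at most `M` in absolute value, then every edge value is at most `(12H² + 2H + 1)·M` (`H ≥ 1`). -/
theorem abs_dirGlue_le_of_sCirc_le (hH : 1 ≤ H) (s : DirFree H → ℝ) {M : ℝ}
    (hM : ∀ (x : Site 4) (i j : Fin 4), |sCirc (dirGlue H s) (x, i, j)| ≤ M)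
    (e : Literature.MathematicalPhysics.QuantumLattice.ZdEdge 4) :
    |dirGlue H s e| ≤ (12 * (H : ℝ) ^ 2 + 2 * H + 1) * M := by
  set V : LGConfig 4 (Multiplicative ℝ) := fun e => Multiplicative.ofAdd (dirGlue H s e) with hV
  have h := ell_le_uniform (fun g : Multiplicative ℝ => |Multiplicative.toAdd g|) (by simp)
    (fun x y => by simpa [toAdd_mul] using abs_add_le (Multiplicative.toAdd x) (Multiplicative.toAdd y))
    (fun x => by simp [toAdd_inv, abs_neg]) V
    (fun e he => by simp [hV, dirGlue_eq_zero_of_not_mem s he])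
    (fun x hx => by
      simp only [hV]
      rw [dirGlue_eq_zero_of_forest s (fun k => by have := hx k; exact ⟨this.1, by exact_mod_cast this.2⟩)]
      rfl)
    (M := M) (fun x i j => by rw [hV, toAdd_plaquetteHolonomyZd_ofAdd]; exact hM x i j) hH e
  simpa [hV] using h

end Summit.QuantumFields.YangMills.Theorems.WeakCouplingRates

end
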